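import Mathlib
import Literature.MathematicalPhysics.QuantumFieldTheory.Balaban1983to89.B6Prop23Assembled

/-!
# `Balaban1983to89.B6Prop23Printed` — p. 238: the census module's verbatim named fact `B6.Prop23Printed`
(Proposition 2.3, (2.86)–(2.87)) DERIVED from the assembled kernel theorem `B6Prop23Assembled.prop23_assembled`

B6 = T. Bałaban, *Propagators and renormalization transformations for lattice gauge theories. II*, Commun. Math. Phys.
**96**, 223–250 (1984) [Balaban1984PropagatorsII].

CITATION HEADER (lean-in-tree rule 2026-08-18).  Cell `pub-balaban`, unit `b2b-balaban-b06-g12` (paper sub-cell B06,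
gen 12 — the owner lineage of `…B6`, `…B6RandomWalk`, `…B6Ineq268`, `…B6Ineq283`, `…B6Expansion282`, `…B6Prop23Chain`,
`…B6Line4Member12`, `…B6Prop23Assembled`).  Source: doi:10.1007/bf01240221, held `paper:balaban1984-cmp96-propagators-
rt-ii`; journal page = PDF page + 222; the quotation below was read from the page render `b2b-balaban-ref1/pages/
1984-cmp96-propagators-rt-II/1984-cmp96-propagators-rt-II-p016-x2.png` (p. 238) AS AN IMAGE.  Cell rows GAPS
C-b06g12-3, DIVERGENCE D-b06.26; journal claim PROP23-PRINTED-EDGE.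

THE PRINTED TEXT.  p. 238 [PDF 16], verbatim: **Proposition 2.3.** *"An inverse of the operator Q′G′²Q′* is given by
the convergent expansion (Q′G′²Q′*)⁻¹ = C(I − R)⁻¹ = Σ_{n=0}^∞ CRⁿ = Σ_ω h_{□₀}C_{□₀}h_{□₀}R_{□₁,□₂}C_{□₂}h_{□₂}·…·
R_{□_{2n−1},□_{2n}}C_{□_{2n}}h_{□_{2n}}, (2.86) and it satisfies the estimate |(Q′G′²Q′*)⁻¹(y, y′)| ≤
O(1)(L^jη)^{−4}(L^{j′}η)^{−d}e^{−½δ₁d(y,y′)} y, y′ ∈ 𝔅, y ∈ Λ_j, y′ ∈ Λ_{j′}. (2.87)"*.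

THE TWO TYPINGS THIS FILE JOINS.  (a) The census module `…B6` types the statement verbatim as the NAMED FACT
`B6.Prop23Printed d geo Cinv` over a family `geo : I → B6.Geometry` of multiscale situations and the carrier kernels
`Cinv i : B6.SiteKernel (geo i)` of (Q′G′²Q′*)⁻¹: *"∃ M₁ δ₁ C > 0, ∀ i, (2.1)–(2.2) → M₁ ≤ M → ∀ y y′, |Cinv(y, y′)| ≤
C (L^jη)^{−4}(L^{j′}η)^{−d}e^{−½δ₁d(y,y′)}"* — a hypothesis of `B6.StatedBlock`, never asserted.  (b) The kernel lineage
proves `B6Prop23Assembled.prop23_assembled`: for ONE situation `g`, under the located cover∕kernel∕geometry inputs of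
pp. 229–237 (hypotheses with free constants; see that module's header THE TYPING) and M ≥ 2Kc, the operator
X = Q′G′²Q′* = K_w(X) has a unique two-sided inverse G with |G(y, y′)| ≤ 2n₀B_C L^{d+4}c·(L^jη)^{−4}(L^{j′}η)^{−d}
e^{−½δ₁d(y,y′)}, the kernel G(y, y′) being `mat G y y′ / (L^{j′}η)^d` in the pairing (2.69).

WHAT THIS MODULE PROVES (kernel-checked; no `sorry`, no axiom beyond Lean's three; bookkeeping only — uniqueness of
the inverse and monotonicity in the constant, no analytic content):
1. `prop23Printed_of_assembled` — THE EDGE (b) ⟹ (a): if every situation of the family satisfies the inputs of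
   `prop23_assembled` with constants UNIFORM in i (δ₀, δ₁ > 0, σ, c_σ, c, c₃, s, m_g, B_X, B_D, B_C, n₀), if M₁ > 0
   dominates every threshold 2K_i c (K_i = `K285 (geo i) …` depends on i through L only) AND gates the second threshold
   of the chain, L_i⁴ ≤ e^{⅛δ₀R_iM_i} for M₁ ≤ M_i (`hthr`, (2.83) member 4 ⇒ 5), if C > 0 dominates every
   2n₀B_C L_i^{d+4}c (so a uniform C presumes the scaling factors L_i bounded along the family — in the print L is one
   fixed integer), and if for M₁ ≤ M_i the carrier kernel `Cinv i` IS the (2.69)-kernel of an inverse of X_i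
   (∃ G, G·K_w(X_i) = 1 ∧ Cinv i (y, y′) = mat G y y′/(L^{j′}η)^d — the dictionary between the abstract carrier of `…B6`
   and the operators of `…B6Expansion282`), then `B6.Prop23Printed d geo Cinv` holds with the witnesses (M₁, δ₁, C).
   The hypothesis (2.1)–(2.2) (`Hyp21_22`) of the named fact is not used (the located inputs replace it).
2. `ptGeo_chain_rate`, `prop23Printed_pt` — CONSISTENCY: the edge applied to the one-point family (every hypothesis
   discharged; Cinv = the unit kernel), so its hypothesis package is not contradictory and the named fact is inhabited
   on that family by this route — non-contradiction only, not satisfiability on a realised multi-cube geometry.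
WHAT IT DOES NOT PROVE: any located input (they are the hypotheses, exactly as in `…B6Prop23Assembled`); that a given
realised family (the lattice geometries of (2.1)–(2.2) with the operators of B5∕B6) satisfies them; uniformity of the
constants in the situation is ASSUMED (it is what the printed "O(1)" asserts and what the located inputs must deliver).
SCOPE CAVEAT inherited from `…B6Prop23Assembled` for any citation of this edge as "Prop. 2.3": supports h_□ on ONE
level (`hlev`) — the printed statement also covers cubes meeting two levels (p. 235, p. 238).  (v1.1: docstrings only —
the `hthr`∕bounded-L∕scope clauses; declarations unchanged.)
Value = kernel certificate that the lineage's assembled theorem has exactly the SHAPE of the printed Proposition 2.3 as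
typed in the census module (real powers (L^jη)^{−4}(L^{j′}η)^{−d}, rate ½δ₁, threshold "M₁ ≤ M"), NOT summit progress.
-/

namespace Literature.MathematicalPhysics.QuantumFieldTheory.Balaban1983to89.B6Prop23Printed

open Literature.MathematicalPhysics.QuantumFieldTheory.Balaban1983to89
open Finset B6RandomWalk B6Lemma21Repaired B6Expansion282 B6Prop23Chain B6Prop23Assembled

/-- **THE EDGE `prop23_assembled` ⟹ `B6.Prop23Printed`.**  For a family of situations `geo : I → B6.Geometry` with
cube data (□ = `pf i`, h_□ = `hf i`, cube scales `js i`), kernels X_i = Q′G′²Q′*, X̃_{i,□}, C_{i,□} in the pairing (2.69)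
and carrier kernels `Cinv i` of (Q′G′²Q′*)⁻¹: the located inputs of `B6Prop23Assembled.prop23_assembled` for every i
with UNIFORM constants, a common threshold M₁ ≥ 2K_i c (*"for M large enough"*), a common constant C ≥ 2n₀B_C L_i^{d+4}c
(*"O(1)"*), and the dictionary "`Cinv i` is the (2.69)-kernel of an inverse of X_i whenever M₁ ≤ M_i" give the printed
Proposition 2.3 in the verbatim typing of `…B6`: *"|(Q′G′²Q′*)⁻¹(y, y′)| ≤ O(1)(L^jη)^{−4}(L^{j′}η)^{−d}e^{−½δ₁d(y,y′)}"*
(2.87), witnesses (M₁, δ₁, C).  Proof: uniqueness of the inverse (`prop23_assembled`) and monotonicity in the constant.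
[cite: Balaban1984PropagatorsII, Prop. 2.3 (2.86)–(2.87) p.238] -/
theorem prop23Printed_of_assembled {I : Type} (d : ℕ) (geo : I → B6.Geometry) [∀ i, DecidableEq (geo i).Site]
    (Cinv : ∀ i, B6.SiteKernel (geo i))
    (htri : ∀ i, Triangle254 (geo i)) (hrefl : ∀ i (y : (geo i).Site), (geo i).dist y y = 0)
    (hd : ∀ i (a b : (geo i).Site), 0 ≤ (geo i).dist a b) (hsep : ∀ i, B6Ineq268.LevelSep (geo i))
    (hL : ∀ i, 1 ≤ (geo i).L) (hη : ∀ i, 0 < (geo i).eta) (hM : ∀ i, 0 < (geo i).M)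
    (hRM : ∀ i, 0 ≤ (geo i).R * (geo i).M)
    {δ₀ δ₁ σ cσ c c₃ s mg BX BD BC M₁ C : ℝ} {n₀ : ℕ}
    (hδ₀ : 0 < δ₀) (hδ₁ : 0 < δ₁) (hsplit : δ₁ + σ * δ₀ ≤ δ₀ / 4)
    (h261σ : ∀ i, Ineq261With cσ (geo i) δ₀ σ)
    (hthr : ∀ i, M₁ ≤ (geo i).M → (geo i).L ^ 4 ≤ Real.exp (1 / 8 * δ₀ * (geo i).R * (geo i).M))
    (h261 : ∀ i, Ineq261With c (geo i) δ₁ (1 / 2)) (h263 : ∀ i, Ineq263With c (geo i) δ₁ (1 / 2)) (hc : 0 ≤ c)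
    (hc₃ : 0 < c₃) (hs : 0 ≤ s) (hmg : 0 < mg) (hBX : 0 ≤ BX) (hBD : 0 ≤ BD) (hBC : 0 ≤ BC)
    (hM₁ : 0 < M₁) (hC : 0 < C)
    (hKM : ∀ i, 2 * K285 (geo i) d n₀ s δ₀ cσ c₃ mg BX BD BC * c ≤ M₁)
    (hCB : ∀ i, 2 * (n₀ * (BC * (geo i).L ^ (d + 4))) * c ≤ C)
    {D : I → Type} [∀ i, Fintype (D i)] [∀ i, DecidableEq (D i)]
    {pf hf : ∀ i, D i → (geo i).Site → ℝ} {js : ∀ i, D i → ℕ} {X : ∀ i, (geo i).Site → (geo i).Site → ℝ}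
    {Xw Ck : ∀ i, D i → (geo i).Site → (geo i).Site → ℝ}
    (hover : ∀ i y, (Finset.univ.filter fun a => hf i a y ≠ 0).card ≤ n₀)
    (hpf01 : ∀ i a y, pf i a y = 0 ∨ pf i a y = 1) (hph : ∀ i a y, pf i a y * hf i a y = hf i a y)
    (h236 : ∀ i y, ∑ a, hf i a y ^ 2 = 1)
    (hLip : ∀ i a y y'', |hf i a y - hf i a y''| ≤ s / (geo i).M * (geo i).dist y y'')
    (hcube : ∀ i a y, pf i a y ≠ 0 → js i a ≤ (geo i).scale y ∧ (geo i).scale y ≤ js i a + 1)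
    (hlev : ∀ i a y y', hf i a y ≠ 0 → hf i a y' ≠ 0 → (geo i).scale y = (geo i).scale y')
    (hgap : ∀ i a y y'', pf i a y = 0 → hf i a y'' ≠ 0 → mg * (geo i).M ≤ (geo i).dist y y'')
    (hX : ∀ i y y'', |(geo i).len y'' ^ d * X i y y''| ≤
      BX * (geo i).len y ^ 4 * Real.exp (-(1 / 2 * δ₀ * (geo i).dist y y'')))
    (hXw : ∀ i a y y'', |(geo i).len y'' ^ d * Xw i a y y''| ≤
      BX * (geo i).len y ^ 4 * Real.exp (-(1 / 2 * δ₀ * (geo i).dist y y'')))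
    (hdom : ∀ i a y y'', |pf i a y * ((geo i).len y'' ^ d * (Xw i a y y'' - X i y y'')) * hf i a y''| ≤
      BD * Real.exp (-(c₃ * (geo i).M)) * (geo i).len y ^ 4 * Real.exp (-(1 / 2 * δ₀ * (geo i).dist y y'')))
    (h281 : ∀ i a y y', pf i a y ≠ 0 → pf i a y' ≠ 0 →
      |Ck i a y y'| ≤ BC / ((geo i).L ^ js i a * (geo i).eta) ^ (d + 4) * Real.exp (-(δ₁ * (geo i).dist y y')))
    (hCk0 : ∀ i a y'' y', pf i a y'' = 0 → Ck i a y'' y' = 0)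
    (h270 : ∀ i a, locOp (fun a => mulOp (pf i a)) (fun a => kerOp (fun z => (geo i).len z ^ d) (Xw i a)) a *
      kerOp (fun z => (geo i).len z ^ d) (Ck i a) * mulOp (hf i a) = mulOp (hf i a))
    (hinv : ∀ i, M₁ ≤ (geo i).M → ∃ G : Module.End ℝ ((geo i).Site → ℝ),
      G * kerOp (fun z => (geo i).len z ^ d) (X i) = 1 ∧
        ∀ y y', (Cinv i).ker y y' = mat G y y' / (geo i).len y' ^ d) :
    B6.Prop23Printed d geo Cinv := by
  refine ⟨M₁, δ₁, C, hM₁, hδ₁, hC, fun i _ hMi y y' => ?_⟩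
  obtain ⟨G, -, -, -, huniq, hb⟩ := prop23_assembled (g := geo i) d (htri i) (hrefl i) (hd i) (hsep i) (hL i)
    (hη i) (hM i) (hRM i) hδ₀ hδ₁.le hsplit (h261σ i) (hthr i hMi) (h261 i) (h263 i) hc hc₃ hs hmg hBX hBD hBC
    (hover i) (hpf01 i) (hph i) (h236 i) (hLip i) (hcube i) (hlev i) (hgap i) (hX i) (hXw i) (hdom i) (h281 i)
    (hCk0 i) (h270 i) ((hKM i).trans hMi)
  obtain ⟨G', hG'X, hker⟩ := hinv i hMi
  rw [hker y y', huniq G' hG'X]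
  refine (hb y y').trans ?_
  have hL0 : 0 < (geo i).L := zero_lt_one.trans_le (hL i)
  have hlen : ∀ z : (geo i).Site, 0 < (geo i).len z := fun z => mul_pos (pow_pos hL0 _) (hη i)
  exact mul_le_mul_of_nonneg_right (mul_le_mul_of_nonneg_right (mul_le_mul_of_nonneg_right (hCB i)
    (Real.rpow_nonneg (hlen y).le _)) (Real.rpow_nonneg (hlen y').le _)) (Real.exp_pos _).le

/-! ## Consistency: the edge on the one-point family -/

/-- On the one-point carrier every chain of kernels e^{−r·d} (d ≡ 0) equals 1. [folklore] -/
theorem ptGeo_chain_rate (r : ℝ) (m : ℕ) (y y' : ptGeo.Site) :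
    B6RandomWalk.chain (fun a b : ptGeo.Site => Real.exp (-(r * ptGeo.dist a b))) m y y' = 1 := by
  have hk : (fun a b : ptGeo.Site => Real.exp (-(r * ptGeo.dist a b))) = fun _ _ => 1 := by
    funext a b; simp
  rw [hk, ptGeo_chain_one]

/-- **NON-VACUITY OF THE EDGE**: on the one-point family (one situation `B6Prop23Assembled.ptGeo`, one cube, □ = h_□ = 1,
unit kernels X = X̃_□ = C_□, δ₀ = 8, δ₁ = 1, σ = s = B_D = 0, c_σ = c = c₃ = m_g = B_X = B_C = 1, n₀ = 1, M₁ = 1, C = 2,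
Cinv = the unit kernel = the (2.69)-kernel of the inverse 1 of X = 1) every hypothesis of `prop23Printed_of_assembled`
is discharged — the term below is the theorem applied there — so the printed named fact holds on that family by this
route and the hypothesis package is not contradictory. [folklore] -/
theorem prop23Printed_pt (d : ℕ) :
    B6.Prop23Printed d (fun _ : Unit => ptGeo) (fun _ => ⟨fun _ _ => (1 : ℝ)⟩) :=
  prop23Printed_of_assembled (geo := fun _ : Unit => ptGeo) d _ (δ₀ := 8) (δ₁ := 1) (σ := 0) (cσ := 1) (c := 1)
    (c₃ := 1) (s := 0) (mg := 1) (BX := 1) (BD := 0) (BC := 1) (M₁ := 1) (C := 2) (n₀ := 1) (D := fun _ => Unit)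
    (pf := fun _ _ _ => 1) (hf := fun _ _ _ => 1) (js := fun _ _ => 0) (X := fun _ _ _ => 1) (Xw := fun _ _ _ _ => 1)
    (Ck := fun _ _ _ _ => 1)
    (fun _ _ _ _ => by simp) (fun _ _ => rfl) (fun _ _ _ => le_rfl)
    (fun _ y y' => by show (0 : ℝ) * 1 * B6Ineq268.mx ptGeo y y' ≤ 0; simp) (fun _ => le_rfl) (fun _ => one_pos)
    (fun _ => one_pos) (fun _ => by show (0 : ℝ) ≤ 0 * 1; norm_num) (by norm_num) one_pos (by norm_num)
    (fun _ _ => by simp) (fun _ _ => by simp) (fun _ _ => by simp)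
    (fun _ m y y' => by rw [ptGeo_chain_rate]; simp) zero_le_one one_pos le_rfl one_pos zero_le_one le_rfl
    zero_le_one one_pos two_pos (fun _ => ptGeo_threshold d) (fun _ => by norm_num)
    (fun _ _ => (Finset.card_filter_le _ _).trans (by simp)) (fun _ _ _ => Or.inr rfl) (fun _ _ _ => one_mul _)
    (fun _ _ => by simp) (fun _ _ _ _ => by simp) (fun _ _ _ _ => ⟨le_rfl, by simp⟩) (fun _ _ _ _ _ _ => rfl)
    (fun _ _ _ _ h _ => absurd h one_ne_zero) (fun _ _ _ => by simp) (fun _ _ _ _ => by simp)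
    (fun _ _ _ _ => by simp) (fun _ _ _ _ _ _ => by simp) (fun _ _ _ _ h => absurd h one_ne_zero)
    (fun _ _ => LinearMap.ext fun μ => funext fun y => by cases y; simp [locOp])
    (fun _ _ => ⟨1, by rw [one_mul]; exact LinearMap.ext fun μ => funext fun y => by cases y; simp,
      fun y y' => by cases y; cases y'; simp [mat]⟩)

end Literature.MathematicalPhysics.QuantumFieldTheory.Balaban1983to89.B6Prop23Printed
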